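import Literature.AlgebraicGeometry.Resolution.PointBlowupMohBoundPrimePower
import Literature.AlgebraicGeometry.Resolution.HasseSchmidtDiffEqDiffOp
import Literature.AlgebraicGeometry.Resolution.OrdZeroBasics
import Literature.AlgebraicGeometry.Resolution.AdditiveFormsStructure
import Literature.AlgebraicGeometry.Resolution.PointBlowupKangaroo
import Literature.AlgebraicGeometry.Resolution.PointBlowupShadeCentres
import Summits.ResolutionOfSingularities.ResolutionOfSingularities.Theorems.PurelyInseparableDim4MohAlong
import Mathlib.Data.Nat.Choose.Lucas
import Mathlib.Data.Nat.Choose.Vandermonde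
import Mathlib.Algebra.Order.Antidiag.Finsupp
import Mathlib.NumberTheory.Padics.PadicVal.Basic
import HarnessLib

/-!
# The Hasse–Euler operators `θ_t^{(ℓ)} = Σ_{|α| = ℓ} (x + t)^α · D^{(α)}` (cell `res-dim4-pi`, I-5-5 Π)

[OURS · counted 0 · instrument lemma]  Nothing here is a statement about resolution of singularities in
dimension ≥ 4 / characteristic `p`, which is NOT proved.  This is the reusable OPERATOR FACT invoked by
the pen proofs of CARD I-5-5's plateau law Π (res-dim4-idea-5; res-dim4-crit-2 V-B-22 add. 2 and
res-dim4-crit-3 V-A3-03 add. 2–3, «Hasse–Euler digit induction»; typing hint crit-3 18:03:44Z), over the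
tree's Hasse–Schmidt derivatives `Resolution.hasseDeriv` (`HasseSchmidtDerivatives`,
`hasseDeriv_monomial`, `coeff_hasseDeriv`, `hasseDeriv_translate`) and `Hauser2010.ordZero`:

* §1 `sum_finsuppAntidiag_prod_choose` — the multivariate Vandermonde identity
  `Σ_{|α| = ℓ} ∏ᵢ C(bᵢ, αᵢ) = C(|b|, ℓ)`;
* §2 `dvd_choose_of_pow_dvd_of_lt` / `natCast_choose_eq_zero_of_pow_dvd_of_lt` — Lucas:
  `p ∣ C(m, a)` for `p^e ∣ m`, `0 < a < p^e` (Mathlib `Choose.choose_modEq_choose_mul_prod_range_choose`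
  at the `p`-adic valuation digit of `a`);
* §3 `theta t ℓ` (a `K`-linear map), `theta_translate` (`θ_t(g(x+t)) = (θ_0 g)(x+t)`),
  `theta_zero_monomial` / `coeff_theta_zero` (DIAGONALITY: `θ_0^{(ℓ)} x^b = C(|b|, ℓ) x^b`),
  `theta_translate_monomial`, `theta_translate_eq_sum`;
* §4 `le_ordZero_hasseDeriv`, **`le_ordZero_theta`** (THE ORDER LEMMA: in characteristic `p`, `q = p^e`,
  `0 < ℓ < q`: if every monomial of `f` of degree `≤ κ` is a `q`-th power then
  `ord₀ (θ_t^{(ℓ)} f) ≥ κ + 1 − ℓ`, every `t`) and the Π-shaped corollary `le_ordZero_translate_diagonal`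
  (`P(x) = Q(x+t)` ⇒ `ord₀ (R_ℓ(x+t)) ≥ κ + 1 − ℓ`, `R_ℓ = Σ_b C(|b|,ℓ) Q_b x^b`).

NOT here: the plateau law Π / `PiPlateau` itself and its regime bookkeeping (idea-5's P-B53 text).
Typed by res-dim4-typ-1.  Supports stmt-ResolutionOfSingularities-16155 (helper).
bears_on: LADDER-RESOLUTION:D157-DOOR2 (res-dim4-pi · I-5-5 Π · Hasse–Euler).
-/

set_option linter.dupNamespace false -- mandated namespace of this single-conjunct summit

namespace Summit.ResolutionOfSingularities.ResolutionOfSingularities.Theorems.PIDim4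

namespace HasseEuler

open MvPolynomial Finset
open Literature.AlgebraicGeometry.Resolution
open Literature.AlgebraicGeometry.Resolution.Hauser2010

/-! ## §1 The multivariate Vandermonde identity -/

/-- **Multivariate Vandermonde**: `Σ_{α : s → ℕ, |α| = ℓ} ∏_{i ∈ s} C(bᵢ, αᵢ) = C(Σ_{i∈s} bᵢ, ℓ)`
(coefficient of `X^ℓ` in `∏ᵢ (1 + X)^{bᵢ} = (1 + X)^{|b|}`). [folklore] -/
theorem sum_finsuppAntidiag_prod_choose {ι : Type*} [DecidableEq ι] (s : Finset ι) (b : ι → ℕ) (ℓ : ℕ) :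
    ∑ α ∈ s.finsuppAntidiag ℓ, ∏ i ∈ s, (b i).choose (α i) = (∑ i ∈ s, b i).choose ℓ := by
  induction s using Finset.induction_on generalizing ℓ with
  | empty =>
    rw [finsuppAntidiag_empty, sum_empty]
    split_ifs with h
    · subst h; simp
    · rw [sum_empty, Nat.choose_eq_zero_of_lt (Nat.pos_of_ne_zero h)]
  | insert a s ha ih =>
    rw [finsuppAntidiag_insert ha, sum_insert ha, Nat.add_choose_eq, sum_biUnion]
    · apply Finset.sum_congr rfl
      simp only [mem_antidiagonal, sum_map, Function.Embedding.coeFn_mk, Finsupp.coe_update, Prod.forall]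
      rintro u v rfl
      rw [← ih v, Finset.mul_sum, ← Finset.sum_attach (s.finsuppAntidiag v)]
      apply Finset.sum_congr rfl
      simp only [mem_attach, Finset.prod_insert ha, Function.update_self, forall_true_left, Subtype.forall]
      rintro x -
      rw [Finset.prod_congr rfl]
      intro i hi
      rw [Function.update_of_ne]
      exact ne_of_mem_of_not_mem hi ha
    · simp only [Set.PairwiseDisjoint, Set.Pairwise, mem_coe, mem_antidiagonal, ne_eq,
        disjoint_left, mem_map, mem_attach, Function.Embedding.coeFn_mk, true_and, Subtype.exists,
        exists_prop, not_exists, not_and, forall_exists_index, and_imp, forall_apply_eq_imp_iff₂,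
        Prod.forall, Prod.mk.injEq]
      rintro u v rfl u' v' huv h k - l - hkl
      obtain rfl : u' = u := by
        simpa only [Finsupp.coe_update, Function.update_self] using DFunLike.congr_fun hkl a
      simp only [add_right_inj] at huv
      exact h rfl huv.symm

/-- The same over all of a finite index type, with the product over the support of `α` (factors
`C(bᵢ, 0) = 1` dropped) — the shape produced by `hasseDeriv_monomial`. [folklore] -/
theorem sum_finsuppAntidiag_univ_prod_support_choose {ι : Type*} [Fintype ι] [DecidableEq ι]
    (b : ι → ℕ) (ℓ : ℕ) :
    ∑ α ∈ (Finset.univ : Finset ι).finsuppAntidiag ℓ, ∏ i ∈ α.support, (b i).choose (α i) =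
      (∑ i, b i).choose ℓ := by
  rw [← sum_finsuppAntidiag_prod_choose]
  refine Finset.sum_congr rfl fun α _ => ?_
  refine Finset.prod_subset (Finset.subset_univ _) fun i _ hi => ?_
  rw [Finsupp.notMem_support_iff.mp hi, Nat.choose_zero_right]

/-! ## §2 Lucas: `C(m, a) ≡ 0 (mod p)` for `p^e ∣ m` and `0 < a < p^e` -/

/-- **Lucas**: if `p^e ∣ m` and `0 < a < p^e` then `p ∣ C(m, a)` (the digit of `a` at its `p`-adic
valuation is non-zero while the corresponding digit of `m` is zero). [folklore] -/
theorem dvd_choose_of_pow_dvd_of_lt (p : ℕ) [hp : Fact p.Prime] {m a e : ℕ} (hm : p ^ e ∣ m)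
    (ha0 : 0 < a) (ha : a < p ^ e) : p ∣ m.choose a := by
  set v := padicValNat p a with hv
  have hpv : p ^ v ∣ a := pow_padicValNat_dvd
  have hpv1 : ¬ p ^ (v + 1) ∣ a := pow_succ_padicValNat_not_dvd ha0.ne'
  have hve : v < e := by
    by_contra hle
    push Not at hle
    have : p ^ e ∣ a := (pow_dvd_pow p hle).trans hpv
    exact absurd (Nat.le_of_dvd ha0 this) (not_le.mpr ha)
  -- the digit of `a` at position `v` is non-zero, that of `m` is zero
  have hda : (a / p ^ v) % p ≠ 0 := by
    intro h0
    apply hpv1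
    obtain ⟨c, hc⟩ := hpv
    have hcp : p ∣ c := by
      have : a / p ^ v = c := by
        rw [hc, Nat.mul_div_cancel_left _ (pow_pos hp.out.pos v)]
      rw [this] at h0
      exact Nat.dvd_of_mod_eq_zero h0
    obtain ⟨c', rfl⟩ := hcp
    exact ⟨c', by rw [hc, pow_succ]; ring⟩
  have hdm : (m / p ^ v) % p = 0 := by
    have h1 : p ^ (v + 1) ∣ m := (pow_dvd_pow p (by omega)).trans hm
    obtain ⟨c, hc⟩ := h1
    have : m / p ^ v = p * c := by
      rw [hc, pow_succ, mul_assoc, Nat.mul_div_cancel_left _ (pow_pos hp.out.pos v)]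
    rw [this, Nat.mul_mod_right]
  -- Lucas' congruence with `e` digits
  have hL := Choose.choose_modEq_choose_mul_prod_range_choose (p := p) (n := m) (k := a) e
  have hzero : ∏ i ∈ Finset.range e, (m / p ^ i % p).choose (a / p ^ i % p) = 0 := by
    apply Finset.prod_eq_zero (Finset.mem_range.mpr hve)
    rw [hdm]
    exact Nat.choose_eq_zero_of_lt (Nat.pos_of_ne_zero hda)
  rw [hzero, Nat.cast_zero, mul_zero] at hL
  have hd := Int.ModEq.dvd hL.symm
  rw [sub_zero] at hd
  exact Int.natCast_dvd_natCast.mp hd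

/-- Hence `C(m, a) = 0` in characteristic `p` when `p^e ∣ m` and `0 < a < p^e`. [folklore] -/
theorem natCast_choose_eq_zero_of_pow_dvd_of_lt (p : ℕ) [Fact p.Prime] (K : Type*) [CommRing K]
    [CharP K p] {m a e : ℕ} (hm : p ^ e ∣ m) (ha0 : 0 < a) (ha : a < p ^ e) :
    ((m.choose a : ℕ) : K) = 0 :=
  (CharP.cast_eq_zero_iff K p _).mpr (dvd_choose_of_pow_dvd_of_lt p hm ha0 ha)

/-! ## §3 The operators `θ_t^{(ℓ)}` and their diagonality in the coordinates `x + t` -/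

section Theta

variable {σ : Type*} {K : Type*} [Field K]

/-- Translation is additive over finite sums. [folklore] -/
theorem translate_sum' {ι : Type*} (t : σ → K) (s : Finset ι) (P : ι → MvPolynomial σ K) :
    PointBlowup.translate t (∑ i ∈ s, P i) = ∑ i ∈ s, PointBlowup.translate t (P i) := by
  unfold PointBlowup.translate; exact map_sum _ _ _

/-- Translation commutes with scalars. [folklore] -/
theorem translate_smul' (t : σ → K) (c : K) (P : MvPolynomial σ K) :
    PointBlowup.translate t (c • P) = c • PointBlowup.translate t P := by
  unfold PointBlowup.translate; exact map_smul _ _ _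

variable [Fintype σ] [DecidableEq σ]

/-- **The Hasse–Euler operator** `θ_t^{(ℓ)} = Σ_{|α| = ℓ} (x + t)^α · D^{(α)}`, a `K`-linear map on
`K[x]`; `(x + t)^α` is `translate t (x^α)` and `D^{(α)}` the tree's Hasse–Schmidt derivative
(`Resolution.hasseDeriv`; translation lemmas `MohAlong.translate_mul` of res-dim4-p-1).  For `t = 0` it is the classical Euler-type operator `Σ_{|α| = ℓ} x^α D^{(α)}`,
diagonal on monomials with eigenvalue `C(|b|, ℓ)` (`theta_zero_monomial`).
[cite: EGAIV4, Thm. 16.11.2 (16.11.2.1) (the divided-power derivations D_p)] [folklore] -/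
noncomputable def theta (t : σ → K) (ℓ : ℕ) : MvPolynomial σ K →ₗ[K] MvPolynomial σ K :=
  ∑ α ∈ (Finset.univ : Finset σ).finsuppAntidiag ℓ,
    (LinearMap.mulLeft K (PointBlowup.translate t (monomial α (1 : K)))).comp (hasseDeriv K α)

/-- Unfolding `θ_t^{(ℓ)} f = Σ_{|α| = ℓ} (x + t)^α · D^{(α)} f`. [folklore] -/
theorem theta_apply (t : σ → K) (ℓ : ℕ) (f : MvPolynomial σ K) :
    theta t ℓ f = ∑ α ∈ (Finset.univ : Finset σ).finsuppAntidiag ℓ,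
      PointBlowup.translate t (monomial α (1 : K)) * hasseDeriv K α f := by
  simp only [theta, LinearMap.coe_sum, Finset.sum_apply, LinearMap.comp_apply, LinearMap.mulLeft_apply]

/-- **Translation covariance**: `θ_t^{(ℓ)} (g(x + t)) = (θ_0^{(ℓ)} g)(x + t)` — the Hasse–Schmidt
derivatives commute with translations (`hasseDeriv_translate`). [folklore] -/
theorem theta_translate (t : σ → K) (ℓ : ℕ) (g : MvPolynomial σ K) :
    theta t ℓ (PointBlowup.translate t g) = PointBlowup.translate t (theta 0 ℓ g) := by
  rw [theta_apply, theta_apply, translate_sum']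
  refine Finset.sum_congr rfl fun α _ => ?_
  rw [hasseDeriv_translate, MohAlong.translate_mul, PointBlowup.translate_zero]

/-- One term of `θ_0^{(ℓ)}` on a monomial: `x^α · D^{(α)}(c x^b) = (∏ᵢ C(bᵢ, αᵢ)) · c x^b` (the
binomial product vanishes when `α ≰ b`). [folklore] -/
theorem monomial_mul_hasseDeriv_monomial (α b : σ →₀ ℕ) (c : K) :
    monomial α (1 : K) * hasseDeriv K α (monomial b c) =
      ((∏ i ∈ α.support, (b i).choose (α i) : ℕ) : K) • monomial b c := by
  rw [hasseDeriv_monomial]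
  by_cases hle : α ≤ b
  · rw [mul_left_comm, monomial_mul, one_mul, add_tsub_cancel_of_le hle, ← map_natCast (C : K →+* _),
      C_mul', ]
  · obtain ⟨i, hi⟩ : ∃ i, b i < α i := by
      by_contra h
      push Not at h
      exact hle fun i => h i
    have hzero : (∏ i ∈ α.support, (b i).choose (α i)) = 0 :=
      Finset.prod_eq_zero (Finsupp.mem_support_iff.mpr (by omega)) (Nat.choose_eq_zero_of_lt hi)
    rw [hzero, Nat.cast_zero, Nat.cast_zero, zero_mul, mul_zero, zero_smul]

/-- **Diagonality at `t = 0`**: `θ_0^{(ℓ)} (c x^b) = C(|b|, ℓ) · c x^b` (multivariate Vandermonde).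
[folklore] -/
theorem theta_zero_monomial (ℓ : ℕ) (b : σ →₀ ℕ) (c : K) :
    theta 0 ℓ (monomial b c) = ((b.degree.choose ℓ : ℕ) : K) • monomial b c := by
  rw [theta_apply]
  simp_rw [PointBlowup.translate_zero, monomial_mul_hasseDeriv_monomial]
  rw [← Finset.sum_smul, ← Nat.cast_sum, sum_finsuppAntidiag_univ_prod_support_choose,
    ← CentreBlowup.degIn_univ]
  rfl

/-- Hence `coeff_d (θ_0^{(ℓ)} f) = C(|d|, ℓ) · coeff_d f`: `θ_0^{(ℓ)}` IS the diagonal operator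
`x^b ↦ C(|b|, ℓ) x^b`. [folklore] -/
theorem coeff_theta_zero (ℓ : ℕ) (f : MvPolynomial σ K) (d : σ →₀ ℕ) :
    coeff d (theta 0 ℓ f) = ((d.degree.choose ℓ : ℕ) : K) * coeff d f := by
  conv_lhs => rw [f.as_sum, map_sum]
  simp_rw [theta_zero_monomial, coeff_sum, coeff_smul, coeff_monomial, smul_eq_mul]
  rw [Finset.sum_eq_single d]
  · simp
  · intro b _ hb; rw [if_neg hb, mul_zero]
  · intro hd; rw [if_pos rfl, MvPolynomial.notMem_support_iff.mp hd, mul_zero]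

/-- **Diagonality in the coordinates `x + t`**: `θ_t^{(ℓ)} (c (x + t)^b) = C(|b|, ℓ) · c (x + t)^b`.
[folklore] -/
theorem theta_translate_monomial (t : σ → K) (ℓ : ℕ) (b : σ →₀ ℕ) (c : K) :
    theta t ℓ (PointBlowup.translate t (monomial b c)) =
      ((b.degree.choose ℓ : ℕ) : K) • PointBlowup.translate t (monomial b c) := by
  rw [theta_translate, theta_zero_monomial, translate_smul']

/-- The general diagonal form: `θ_t^{(ℓ)} (g(x + t)) = (Σ_b C(|b|, ℓ) g_b x^b)(x + t)`. [folklore] -/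
theorem theta_translate_eq_sum (t : σ → K) (ℓ : ℕ) (g : MvPolynomial σ K) :
    theta t ℓ (PointBlowup.translate t g) =
      PointBlowup.translate t (∑ b ∈ g.support, ((b.degree.choose ℓ : ℕ) : K) • monomial b (coeff b g)) := by
  rw [theta_translate]
  congr 1
  conv_lhs => rw [g.as_sum, map_sum]
  simp_rw [theta_zero_monomial]

end Theta

/-! ## §4 The order lemma: `θ_t^{(ℓ)}` kills `q`-th powers and lowers the order by at most `ℓ` -/

section Order

variable {σ : Type*} {K : Type*} [Field K]

/-- The binomial product of `coeff_hasseDeriv` vanishes in characteristic `p` on a `q`-th-power exponent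
(`q = p^e`) for `0 < |α| < q`. [folklore] -/
theorem prod_choose_eq_zero_of_pow_dvd (p : ℕ) [Fact p.Prime] [CharP K p] {e : ℕ} {α m : σ →₀ ℕ}
    (hα0 : α ≠ 0) (hα : α.degree < p ^ e) (hm : ∀ i, p ^ e ∣ m i) :
    ((∏ i ∈ α.support, (m i).choose (α i) : ℕ) : K) = 0 := by
  obtain ⟨i, hi⟩ := Finsupp.support_nonempty_iff.mpr hα0
  rw [Nat.cast_prod]
  apply Finset.prod_eq_zero hi
  have hαi : 0 < α i := Nat.pos_of_ne_zero (Finsupp.mem_support_iff.mp hi)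
  have hαq : α i < p ^ e := lt_of_le_of_lt (Finsupp.le_degree i α) hα
  exact natCast_choose_eq_zero_of_pow_dvd_of_lt p K (hm i) hαi hαq

variable [DecidableEq σ]

/-- **The Hasse–Schmidt derivative `D^{(α)}`, `0 < |α| < q = p^e`, kills the `q`-th-power monomials of
degree `≤ κ` and lowers the order of the rest by `|α|`**: if every monomial of `f` of total degree
`≤ κ` is a `q`-th power, then `ord₀ (D^{(α)} f) ≥ κ + 1 − |α|`. [folklore] -/
theorem le_ordZero_hasseDeriv (p : ℕ) [Fact p.Prime] [CharP K p] {e κ : ℕ} {α : σ →₀ ℕ}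
    (hα0 : α ≠ 0) (hα : α.degree < p ^ e) (f : MvPolynomial σ K)
    (hf : ∀ d ∈ f.support, d.degree ≤ κ → ∀ i, p ^ e ∣ d i) :
    ((κ + 1 - α.degree : ℕ) : ℕ∞) ≤ ordZero (hasseDeriv K α f) := by
  rw [natCast_le_ordZero_iff_forall_coeff]
  intro d hd
  rw [coeff_hasseDeriv]
  by_cases hmem : α + d ∈ f.support
  · have hdeg : (α + d).degree ≤ κ := by
      rw [map_add]; omega
    rw [prod_choose_eq_zero_of_pow_dvd p hα0 hα (hf _ hmem hdeg), zero_mul]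
  · rw [MvPolynomial.notMem_support_iff.mp hmem, mul_zero]

variable [Fintype σ]

/-- **THE ORDER LEMMA** (step 1 of the Hasse–Euler digit induction for Π, cell `res-dim4-pi` I-5-5,
res-dim4-crit-2 / crit-3): in characteristic `p`, with `q = p^e` and `0 < ℓ < q`, if every monomial
`x^d` of `f` of total degree `≤ κ` is a `q`-th power (`q ∣ dᵢ` for all `i`), then
`ord₀ (θ_t^{(ℓ)} f) ≥ κ + 1 − ℓ` for EVERY `t`. [folklore] -/
theorem le_ordZero_theta (p : ℕ) [Fact p.Prime] [CharP K p] {e ℓ κ : ℕ} (hℓ0 : 0 < ℓ)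
    (hℓ : ℓ < p ^ e) (t : σ → K) (f : MvPolynomial σ K)
    (hf : ∀ d ∈ f.support, d.degree ≤ κ → ∀ i, p ^ e ∣ d i) :
    ((κ + 1 - ℓ : ℕ) : ℕ∞) ≤ ordZero (theta t ℓ f) := by
  rw [theta_apply]
  apply le_ordZero_sum
  intro α hα
  rw [mem_finsuppAntidiag] at hα
  have hdeg : α.degree = ℓ := by rw [← CentreBlowup.degIn_univ]; exact hα.1
  have hα0 : α ≠ 0 := by
    intro h; rw [h, map_zero] at hdeg; omega
  refine le_trans ?_ (le_ordZero_mul_left _ _)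
  rw [← hdeg]
  exact le_ordZero_hasseDeriv p hα0 (hdeg ▸ hℓ) f hf

/-- **The form used in the Π digit induction** (res-dim4-crit-3 V-A3-03 add. 2 / crit-2 V-B-22 add. 2):
if `P(x) = Q(x + t)` and every monomial of `P` of degree `≤ κ` is a `q`-th power (`q = p^e`), then for
`0 < ℓ < q` the translated diagonal image `R_ℓ(x + t)`, `R_ℓ := Σ_b C(|b|, ℓ) Q_b x^b`, has
`ord₀ ≥ κ + 1 − ℓ` — because `R_ℓ(x + t) = θ_t^{(ℓ)} P` (`theta_translate_eq_sum`). [folklore] -/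
theorem le_ordZero_translate_diagonal (p : ℕ) [Fact p.Prime] [CharP K p] {e ℓ κ : ℕ} (hℓ0 : 0 < ℓ)
    (hℓ : ℓ < p ^ e) (t : σ → K) (Q : MvPolynomial σ K)
    (hP : ∀ d ∈ (PointBlowup.translate t Q).support, d.degree ≤ κ → ∀ i, p ^ e ∣ d i) :
    ((κ + 1 - ℓ : ℕ) : ℕ∞) ≤
      ordZero (PointBlowup.translate t
        (∑ b ∈ Q.support, ((b.degree.choose ℓ : ℕ) : K) • monomial b (coeff b Q))) := by
  rw [← theta_translate_eq_sum]
  exact le_ordZero_theta p hℓ0 hℓ t _ hP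

end Order

end HasseEuler

end Summit.ResolutionOfSingularities.ResolutionOfSingularities.Theorems.PIDim4
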